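import Literature.MathematicalPhysics.KineticTheory.CellTransferOperator

/-!
# The flat-profile Gaussian state of the pinned harmonic host (`ω₂ = 1/2`, `T = 1`)

Topic `Literature/MathematicalPhysics/KineticTheory`, grouping namespace `…KineticTheory.HeatConduction`
(as `CellTransferOperator.lean`, whose `profileCovQQ/PP/QP`, `IsProfileState`, `hostBandMeasure` are used),
sub-namespace `FlatProfileState` for the construction.

CONTENT. A Gaussian probability measure `ν` on `ChainConfig = ℤ → ℝ × ℝ` with
`IsGaussian ν ∧ IsProfileState (1/2) ν (fun _ => 1)` (`exists_isGaussian_isProfileState`) — the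
thermal state of the harmonic host at temperature `1`, pinning `ω₂ = 1/2` — showing that the
profile-state vocabulary of `CellTransferOperator.lean` is inhabited by an honest non-degenerate state.

CONSTRUCTION. Source: `Measure.infinitePi (fun _ : ℤ ⊕ ℤ => gaussianReal 0 1)`.  Positions: the
two-sided stationary AR(1) field built OUTWARD from the origin, `Q₀ = c₀ ξ₀`,
`Q_{±(n+1)} = a Q_{±n} + s ξ_{±(n+1)}` with `a = 1/2`, `c₀² = σ²`, `s² = σ²(1 - a²)`, so
`cov[Q m, Q n] = σ² a^{|m-n|}` (proved by the recursion, no index gymnastics); momenta: fresh white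
coordinates.  ANALYSIS without closed-form integrals: `J r := ∫ cos(k r)/(5/2 - 2cos k) dk` over the
band obeys `(5/2) J ℓ = J(ℓ+1) + J(ℓ-1)` (`ℓ ≠ 0`, product-to-sum and `∫ cos(kℓ) = 0`) and is bounded,
so the growing lattice mode is absent and `J ℓ = 2^{-|ℓ|} J 0`; hence
`profileCovQQ (1/2) 1 m n = σ² 2^{-|m-n|}` with `σ² := (2π)⁻¹ J 0 ≥ 0`, `profileCovPP 1 m n = [m = n]`,
`profileCovQP = 0` (tree).  GAUSSIANITY on the infinite product: a continuous linear functional on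
`ι → F` (product topology) depends on finitely many coordinates (`clm_pi_finite_support`), and every
coordinate of the field is a finite linear combination of the independent Gaussian source
(`IsGaussianProcess.of_isGaussianProcess`), whence `isGaussian_of_isGaussian_map`.

NOT HERE: general `ω₂, T` (same proof with `a = κ⁻¹`, `κ + κ⁻¹ = 2 + ω₂`, and `√T`), general
profiles `ϑ` (needs spectral synthesis / Kolmogorov extension), dynamics or invariance of `ν`.
Sources: folklore (Gaussian AR(1) processes; lattice Green's function of `-Δ + ω₂` on `ℤ`).
-/

namespace Literature.MathematicalPhysics.KineticTheory.HeatConduction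

namespace FlatProfileState

open _root_.MeasureTheory ProbabilityTheory Filter Set Function Finset
open scoped _root_.Topology ENNReal NNReal

noncomputable section

/-- `∫_{(-π,π)} cos(k r) dk` vanishes for every nonzero integer `r`. [folklore] -/
theorem integral_cos_mul_intCast {ℓ : ℤ} (hℓ : ℓ ≠ 0) :
    ∫ k, Real.cos (k * ℓ) ∂hostBandMeasure = 0 := by
  have hℓ' : (ℓ : ℝ) ≠ 0 := Int.cast_ne_zero.2 hℓ
  rw [hostBandMeasure, hostBand, ← integral_Ioc_eq_integral_Ioo,
    ← intervalIntegral.integral_of_le (by linarith [Real.pi_pos] : -Real.pi ≤ Real.pi),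
    intervalIntegral.integral_comp_mul_right (fun x => Real.cos x) hℓ', integral_cos]
  have h1 : Real.sin (Real.pi * ℓ) = 0 := by
    rw [mul_comm]; exact_mod_cast Real.sin_int_mul_pi ℓ
  have h2 : Real.sin (-Real.pi * ℓ) = 0 := by
    rw [neg_mul, Real.sin_neg, h1, neg_zero]
  simp [h1]

/-- the denominator `5/2 - 2 cos k` is at least `1/2` [folklore] -/
theorem den_pos (k : ℝ) : (1 / 2 : ℝ) ≤ 5 / 2 - 2 * Real.cos k := by
  linarith [Real.cos_le_one k]

/-- Continuity of the denominator `5/2 - 2 cos k`. [folklore] -/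
theorem continuous_den : Continuous fun k : ℝ => 5 / 2 - 2 * Real.cos k := by fun_prop

/-- the integrand family [folklore] -/
def jint (r k : ℝ) : ℝ := Real.cos (k * r) / (5 / 2 - 2 * Real.cos k)

/-- The integrand is continuous. [folklore] -/
theorem continuous_jint (r : ℝ) : Continuous (jint r) := by
  unfold jint
  refine Continuous.div (by fun_prop) continuous_den fun k => ?_
  linarith [den_pos k]

/-- The integrand is bounded by `2`. [folklore] -/
theorem abs_jint_le (r k : ℝ) : |jint r k| ≤ 2 := by
  unfold jint
  rw [abs_div, abs_of_pos (by linarith [den_pos k] : (0:ℝ) < 5 / 2 - 2 * Real.cos k),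
    div_le_iff₀ (by linarith [den_pos k])]
  have := Real.abs_cos_le_one (k * r)
  linarith [den_pos k]

/-- The integrand is integrable on the band. [folklore] -/
theorem integrable_jint (r : ℝ) : Integrable (jint r) hostBandMeasure := by
  refine Integrable.mono' (integrable_const (2 : ℝ)) (continuous_jint r).aestronglyMeasurable ?_
  exact Eventually.of_forall fun k => by rw [Real.norm_eq_abs]; exact abs_jint_le r k

/-- `cos(k r)` is integrable on the band. [folklore] -/
theorem integrable_cos_mul (r : ℝ) : Integrable (fun k => Real.cos (k * r)) hostBandMeasure := by
  refine Integrable.mono' (integrable_const (1 : ℝ)) (by fun_prop : Continuous fun k => Real.cos (k * r)).aestronglyMeasurable ?_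
  exact Eventually.of_forall fun k => by rw [Real.norm_eq_abs]; exact Real.abs_cos_le_one _

/-- `J r = ∫ cos(k r)/(5/2 - 2cos k) dk` [folklore] -/
def J (r : ℝ) : ℝ := ∫ k, jint r k ∂hostBandMeasure

/-- `J` is even. [folklore] -/
theorem J_neg (r : ℝ) : J (-r) = J r := by
  unfold J jint
  congr 1; funext k
  rw [mul_neg, Real.cos_neg]

/-- `|J r| ≤ 4π`. [folklore] -/
theorem abs_J_le (r : ℝ) : |J r| ≤ 2 * (2 * Real.pi) := by
  unfold J
  have h := norm_integral_le_of_norm_le_const (μ := hostBandMeasure) (f := jint r) (C := 2)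
    (Eventually.of_forall fun k => by rw [Real.norm_eq_abs]; exact abs_jint_le r k)
  rw [Real.norm_eq_abs] at h
  refine h.trans (le_of_eq ?_)
  rw [Measure.real, hostBandMeasure_univ, ENNReal.toReal_ofReal (by positivity)]

/-- the lattice recurrence: `(5/2) J ℓ - J (ℓ+1) - J (ℓ-1) = ∫ cos(kℓ) dk` [folklore] -/
theorem J_rec (r : ℝ) :
    (5 / 2) * J r - J (r + 1) - J (r - 1) = ∫ k, Real.cos (k * r) ∂hostBandMeasure := by
  unfold J
  rw [← integral_const_mul, ← integral_sub, ← integral_sub]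
  · refine integral_congr_ae (Eventually.of_forall fun k => ?_)
    have hd : (5 / 2 - 2 * Real.cos k) ≠ 0 := by linarith [den_pos k]
    simp only [jint]
    rw [mul_add, mul_one, mul_sub, mul_one, Real.cos_add, Real.cos_sub]
    rw [show (5 / 2 : ℝ) * (Real.cos (k * r) / (5 / 2 - 2 * Real.cos k)) -
        (Real.cos (k * r) * Real.cos k - Real.sin (k * r) * Real.sin k) / (5 / 2 - 2 * Real.cos k) -
        (Real.cos (k * r) * Real.cos k + Real.sin (k * r) * Real.sin k) / (5 / 2 - 2 * Real.cos k) =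
        Real.cos (k * r) * (5 / 2 - 2 * Real.cos k) / (5 / 2 - 2 * Real.cos k) from by ring,
      mul_div_assoc, div_self hd, mul_one]
  · exact ((integrable_jint r).const_mul _).sub (integrable_jint _)
  · exact integrable_jint _
  · exact (integrable_jint r).const_mul _
  · exact integrable_jint _

/-- the decaying-mode extraction: `J (n+1) = J n / 2` for all naturals `n` [folklore] -/
theorem J_succ (n : ℕ) : J ((n : ℝ) + 1) = J n / 2 := by
  -- D n := J (n+1) - J n / 2 satisfies D (n+1) = 2 D n and is bounded, hence vanishes
  set D : ℕ → ℝ := fun n => J ((n : ℝ) + 1) - J n / 2 with hD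
  have hrec : ∀ n : ℕ, D (n + 1) = 2 * D n := by
    intro n
    have h := J_rec ((n : ℝ) + 1)
    have h0 := integral_cos_mul_intCast (ℓ := (n : ℤ) + 1) (by omega)
    push_cast at h0
    rw [h0] at h
    simp only [hD]
    push_cast
    have e : (n : ℝ) + 1 - 1 = n := by ring
    rw [e] at h
    linarith
  have hpow : ∀ n : ℕ, D n = 2 ^ n * D 0 := by
    intro n
    induction n with
    | zero => simp
    | succ n ih => rw [hrec, ih, pow_succ]; ring
  have hbdd : ∀ n : ℕ, |D n| ≤ 3 * (2 * (2 * Real.pi)) := by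
    intro n
    simp only [hD]
    have h1 := abs_J_le ((n : ℝ) + 1)
    have h2 := abs_J_le (n : ℝ)
    calc |J ((n : ℝ) + 1) - J n / 2| ≤ |J ((n : ℝ) + 1)| + |J n / 2| := abs_sub _ _
      _ = |J ((n : ℝ) + 1)| + |J n| / 2 := by rw [abs_div, abs_two]
      _ ≤ _ := by linarith [abs_nonneg (J n)]
  have hD0 : D 0 = 0 := by
    by_contra hne
    have hpos : 0 < |D 0| := abs_pos.2 hne
    -- 2^n |D 0| is unbounded
    obtain ⟨n, hn⟩ : ∃ n : ℕ, 3 * (2 * (2 * Real.pi)) / |D 0| < 2 ^ n :=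
      pow_unbounded_of_one_lt _ one_lt_two
    have := hbdd n
    rw [hpow n, abs_mul, abs_of_pos (by positivity : (0:ℝ) < 2 ^ n)] at this
    rw [div_lt_iff₀ hpos] at hn
    linarith
  have hDn : D n = 0 := by rw [hpow, hD0, mul_zero]
  simp only [hD] at hDn
  linarith

/-- `J n = 2^{-n} J 0` for naturals. [folklore] -/
theorem J_natCast (n : ℕ) : J n = (1 / 2) ^ n * J 0 := by
  induction n with
  | zero => simp
  | succ n ih =>
      push_cast
      rw [J_succ, ih, pow_succ]
      ring

/-- `J ℓ = 2^{-|ℓ|} J 0` for integers. [folklore] -/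
theorem J_intCast (ℓ : ℤ) : J ℓ = (1 / 2) ^ ℓ.natAbs * J 0 := by
  obtain ⟨n, rfl | rfl⟩ := Int.eq_nat_or_neg ℓ
  · rw [Int.cast_natCast, J_natCast, Int.natAbs_natCast]
  · rw [Int.cast_neg, Int.cast_natCast, J_neg, J_natCast, Int.natAbs_neg, Int.natAbs_natCast]

/-- `0 ≤ J 0` (positive integrand). [folklore] -/
theorem J_zero_nonneg : 0 ≤ J 0 := by
  unfold J jint
  refine integral_nonneg fun k => ?_
  simp only [mul_zero, Real.cos_zero]
  exact div_nonneg zero_le_one (by linarith [den_pos k])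

/-- the flat-profile position variance at `ω₂ = 1/2`, `T = 1` [folklore] -/
def sigmaSq : ℝ := (2 * Real.pi)⁻¹ * J 0

/-- `0 ≤ σ²`. [folklore] -/
theorem sigmaSq_nonneg : 0 ≤ sigmaSq := mul_nonneg (by positivity) J_zero_nonneg

/-- `profileCovQQ (1/2) 1 m n = σ² 2^{-|m-n|}` [folklore] -/
theorem profileCovQQ_flat (m n : ℤ) :
    profileCovQQ (1 / 2) (fun _ => (1 : ℝ)) m n = sigmaSq * (1 / 2) ^ (m - n).natAbs := by
  unfold profileCovQQ sigmaSq
  have hint : ∫ k, (1 : ℝ) / hostDispersion (1 / 2) k ^ 2 * Real.cos (k * ((m : ℝ) - n)) ∂hostBandMeasure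
      = J ((m - n : ℤ) : ℝ) := by
    unfold J jint
    refine integral_congr_ae (Eventually.of_forall fun k => ?_)
    show 1 / hostDispersion (1 / 2) k ^ 2 * Real.cos (k * ((m : ℝ) - n)) =
      Real.cos (k * ((m - n : ℤ) : ℝ)) / (5 / 2 - 2 * Real.cos k)
    rw [hostDispersion_sq (by norm_num : (0:ℝ) ≤ 1 / 2)]
    push_cast
    have hd : (1 / 2 + 2 - 2 * Real.cos k) = 5 / 2 - 2 * Real.cos k := by ring
    rw [hd, one_div_mul_eq_div]
  rw [hint, J_intCast]
  ring

/-- `profileCovPP 1 m n = [m = n]` [folklore] -/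
theorem profileCovPP_flat (m n : ℤ) :
    profileCovPP (fun _ => (1 : ℝ)) m n = if m = n then 1 else 0 := by
  split_ifs with h
  · subst h; exact profileCovPP_const_self 1 m
  · unfold profileCovPP
    have : ∫ k, (1 : ℝ) * Real.cos (k * ((m : ℝ) - n)) ∂hostBandMeasure = 0 := by
      simp only [one_mul]
      have h' : (m - n : ℤ) ≠ 0 := sub_ne_zero.2 h
      have := integral_cos_mul_intCast h'
      push_cast at this
      exact this
    rw [this, mul_zero]


/-- source index: `inl` for the innovations of the position field, `inr` for the momenta [folklore] -/
abbrev Idx : Type := ℤ ⊕ ℤ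
/-- source space [folklore] -/
abbrev Src : Type := Idx → ℝ

/-- the infinite product of standard Gaussians [folklore] -/
def srcMeasure : Measure Src := Measure.infinitePi fun _ : Idx => gaussianReal 0 1

/-- The source measure is a probability measure. [folklore] -/
instance : IsProbabilityMeasure srcMeasure := by unfold srcMeasure; infer_instance


/-- coordinates [folklore] -/
def X (i : Idx) : Src → ℝ := fun ζ => ζ i

/-- Coordinates are measurable. [folklore] -/
theorem measurable_X (i : Idx) : Measurable (X i) := measurable_pi_apply i

/-- Each coordinate is standard Gaussian. [folklore] -/
theorem map_X (i : Idx) : Measure.map (X i) srcMeasure = gaussianReal 0 1 :=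
  (measurePreserving_eval_infinitePi (fun _ : Idx => gaussianReal 0 1) i).map_eq

/-- Coordinates are square integrable. [folklore] -/
theorem memLp_X (i : Idx) : MemLp (X i) 2 srcMeasure := by
  have h : MemLp id 2 (Measure.map (X i) srcMeasure) := by
    rw [map_X]; exact memLp_id_gaussianReal' 2 (by simp)
  exact h.comp_of_map (measurable_X i).aemeasurable

/-- Coordinates are centred. [folklore] -/
theorem integral_X (i : Idx) : ∫ ζ, X i ζ ∂srcMeasure = 0 := by
  have h := integral_map (μ := srcMeasure) (φ := X i) (measurable_X i).aemeasurable
    (f := fun x : ℝ => x) aestronglyMeasurable_id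
  rw [map_X, integral_id_gaussianReal] at h
  exact h.symm

/-- Coordinates are mutually independent. [folklore] -/
theorem iIndepFun_X : iIndepFun X srcMeasure :=
  iIndepFun_infinitePi (P := fun _ : Idx => gaussianReal 0 1) (X := fun _ x => x)
    fun _ => measurable_id

/-- Coordinates are orthonormal: `cov[X i, X j] = [i = j]`. [folklore] -/
theorem covariance_X_X (i j : Idx) : cov[X i, X j; srcMeasure] = if i = j then 1 else 0 := by
  split_ifs with h
  · subst h
    rw [covariance_self (measurable_X i).aemeasurable]
    have hv := variance_map (μ := srcMeasure) (X := fun x : ℝ => x) (Y := X i)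
      aemeasurable_id (measurable_X i).aemeasurable
    rw [map_X, variance_fun_id_gaussianReal] at hv
    have e : ((fun x : ℝ => x) ∘ X i) = X i := rfl
    rw [e] at hv
    simpa using hv.symm
  · exact (iIndepFun_X.indepFun h).covariance_eq_zero (memLp_X i) (memLp_X j)

/-! ## finite linear combinations of coordinates along a node map -/

/-- `linc κ node w ζ = ∑_{b ∈ κ} w b * ζ (node b)` [folklore] -/
def linc {β : Type*} (κ : Finset β) (node : β → Idx) (w : β → ℝ) : Src → ℝ :=
  fun ζ => ∑ b ∈ κ, w b * X (node b) ζ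

section Linc

variable {β : Type*} (κ : Finset β) (node : β → Idx) (w : β → ℝ)

/-- Linear combinations are square integrable. [folklore] -/
theorem memLp_linc : MemLp (linc κ node w) 2 srcMeasure :=
  memLp_finsetSum κ (f := fun b ζ => w b * X (node b) ζ) fun b _ => (memLp_X (node b)).const_mul (w b)

/-- Linear combinations are continuous. [folklore] -/
theorem continuous_linc : Continuous (linc κ node w) := by
  unfold linc X; fun_prop

/-- Linear combinations are centred. [folklore] -/
theorem integral_linc : ∫ ζ, linc κ node w ζ ∂srcMeasure = 0 := by
  unfold linc
  rw [integral_finsetSum κ (f := fun b ζ => w b * X (node b) ζ)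
    fun b _ => ((memLp_X (node b)).integrable one_le_two).const_mul (w b)]
  refine Finset.sum_eq_zero fun b _ => ?_
  rw [integral_const_mul, integral_X, mul_zero]

/-- covariance of a linear combination with a coordinate [folklore] -/
theorem covariance_linc_X (k : Idx) :
    cov[linc κ node w, X k; srcMeasure] = ∑ b ∈ κ, if node b = k then w b else 0 := by
  unfold linc
  rw [covariance_fun_sum_left' (X := fun b ω => w b * X (node b) ω)
    (fun b _ => (memLp_X (node b)).const_mul (w b)) (memLp_X k)]
  refine Finset.sum_congr rfl fun b _ => ?_
  rw [covariance_const_mul_left, covariance_X_X]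
  split_ifs <;> simp

/-- a coordinate not among the nodes is uncorrelated with the combination [folklore] -/
theorem covariance_linc_X_of_fresh {k : Idx} (hk : ∀ b ∈ κ, node b ≠ k) :
    cov[linc κ node w, X k; srcMeasure] = 0 := by
  rw [covariance_linc_X]
  exact Finset.sum_eq_zero fun b hb => if_neg (hk b hb)

end Linc

/-! ## the outward AR(1) branches -/

section Branch

variable (a c₀ s : ℝ)

/-- nodes of a branch: `0 ↦ inl 0`, `j+1 ↦ e (j+1)` [folklore] -/
def node (e : ℕ → Idx) : ℕ → Idx := fun j => if j = 0 then Sum.inl 0 else e j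

/-- coefficients at generation `n`: `c₀ aⁿ` on the origin, `s a^{n-j}` on innovation `j` [folklore] -/
def coef (n j : ℕ) : ℝ := if j = 0 then c₀ * a ^ n else s * a ^ (n - j)

/-- the branch random variables [folklore] -/
def QB (e : ℕ → Idx) (n : ℕ) : Src → ℝ := linc (Finset.range (n + 1)) (node e) (coef a c₀ s n)

variable {a c₀ s}

/-- Branch variables are square integrable. [folklore] -/
theorem memLp_QB (e : ℕ → Idx) (n : ℕ) : MemLp (QB a c₀ s e n) 2 srcMeasure := memLp_linc _ _ _

/-- Branch variables are centred. [folklore] -/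
theorem integral_QB (e : ℕ → Idx) (n : ℕ) : ∫ ζ, QB a c₀ s e n ζ ∂srcMeasure = 0 := integral_linc _ _ _

/-- the AR(1) recursion [folklore] -/
theorem QB_succ (e : ℕ → Idx) (n : ℕ) :
    QB a c₀ s e (n + 1) = fun ζ => a * QB a c₀ s e n ζ + s * ζ (e (n + 1)) := by
  funext ζ
  simp only [QB, linc, X]
  rw [Finset.sum_range_succ, Finset.mul_sum]
  congr 1
  · refine Finset.sum_congr rfl fun j hj => ?_
    rw [Finset.mem_range] at hj
    simp only [coef]
    split_ifs with h0
    · ring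
    · rw [show n + 1 - j = (n - j) + 1 by omega, pow_succ]; ring
  · simp [node, coef]

/-- the origin variable [folklore] -/
theorem QB_zero (e : ℕ → Idx) : QB a c₀ s e 0 = fun ζ => c₀ * ζ (Sum.inl 0) := by
  funext ζ; simp [QB, linc, node, coef, X]

/-- a FRESH coordinate (not the origin, not an innovation of generation ≤ n) is uncorrelated [folklore] -/
theorem covariance_QB_X_fresh {e : ℕ → Idx} {n : ℕ} {k : Idx} (hk0 : k ≠ Sum.inl 0)
    (hk : ∀ j, 1 ≤ j → j ≤ n → e j ≠ k) : cov[QB a c₀ s e n, X k; srcMeasure] = 0 := by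
  refine covariance_linc_X_of_fresh _ _ _ fun j hj => ?_
  rw [Finset.mem_range] at hj
  simp only [node]
  split_ifs with h0
  · exact hk0.symm
  · exact hk j (by omega) (by omega)

/-- one recursion step inside a covariance [folklore] -/
theorem covariance_QB_succ_right (e : ℕ → Idx) (n : ℕ) {Y : Src → ℝ} (hY : MemLp Y 2 srcMeasure) :
    cov[Y, QB a c₀ s e (n + 1); srcMeasure] = a * cov[Y, QB a c₀ s e n; srcMeasure] + s * cov[Y, X (e (n + 1)); srcMeasure] := by
  rw [QB_succ]
  rw [show (fun ζ => a * QB a c₀ s e n ζ + s * ζ (e (n + 1))) =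
      (fun ζ => a * QB a c₀ s e n ζ) + fun ζ => s * X (e (n + 1)) ζ from rfl]
  rw [covariance_add_right hY ((memLp_QB e n).const_mul a) ((memLp_X _).const_mul s),
    covariance_const_mul_right, covariance_const_mul_right]

variable (σ2 : ℝ) (hc : c₀ ^ 2 = σ2) (hs : s ^ 2 = σ2 * (1 - a ^ 2))

include hc hs in
/-- stationarity of the variance along a branch [folklore] -/
theorem covariance_QB_self {e : ℕ → Idx} (he : (∀ j, 1 ≤ j → e j ≠ Sum.inl 0) ∧ ∀ i j, 1 ≤ i → 1 ≤ j → e i = e j → i = j) (n : ℕ) :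
    cov[QB a c₀ s e n, QB a c₀ s e n; srcMeasure] = σ2 := by
  induction n with
  | zero =>
      rw [QB_zero, show (fun ζ : Src => c₀ * ζ (Sum.inl 0)) = fun ζ => c₀ * X (Sum.inl 0) ζ from rfl,
        covariance_const_mul_left, covariance_const_mul_right, covariance_X_X, if_pos rfl, ← hc]
      ring
  | succ n ih =>
      have hfresh : cov[QB a c₀ s e n, X (e (n + 1)); srcMeasure] = 0 :=
        covariance_QB_X_fresh (he.1 _ (by omega))
          fun j hj1 hjn heq => by have := he.2 _ _ hj1 (by omega) heq; omega
      rw [covariance_QB_succ_right e n (memLp_QB e (n + 1)), covariance_comm,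
        covariance_QB_succ_right e n (memLp_QB e n), ih, hfresh,
        covariance_comm, covariance_QB_succ_right e n (memLp_X _), covariance_comm, hfresh,
        covariance_X_X, if_pos rfl]
      nlinarith [hs]

include hc hs in
/-- covariance along a branch: `σ² a^d` at lag `d` [folklore] -/
theorem covariance_QB_QB {e : ℕ → Idx} (he : (∀ j, 1 ≤ j → e j ≠ Sum.inl 0) ∧ ∀ i j, 1 ≤ i → 1 ≤ j → e i = e j → i = j) (m d : ℕ) :
    cov[QB a c₀ s e m, QB a c₀ s e (m + d); srcMeasure] = σ2 * a ^ d := by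
  induction d with
  | zero => rw [add_zero, covariance_QB_self σ2 hc hs he, pow_zero, mul_one]
  | succ d ih =>
      have hfresh : cov[QB a c₀ s e m, X (e (m + d + 1)); srcMeasure] = 0 :=
        covariance_QB_X_fresh (he.1 _ (by omega))
          fun j hj1 hjn heq => by have := he.2 _ _ hj1 (by omega) heq; omega
      rw [show m + (d + 1) = (m + d) + 1 by ring, covariance_QB_succ_right e _ (memLp_QB e m),
        ih, hfresh, pow_succ]
      ring

include hc hs in
/-- covariance ACROSS two branches with disjoint innovations: `σ² a^{m+n}` [folklore] -/
theorem covariance_QB_QB' {e e' : ℕ → Idx} (he : (∀ j, 1 ≤ j → e j ≠ Sum.inl 0) ∧ ∀ i j, 1 ≤ i → 1 ≤ j → e i = e j → i = j) (he' : (∀ j, 1 ≤ j → e' j ≠ Sum.inl 0) ∧ ∀ i j, 1 ≤ i → 1 ≤ j → e' i = e' j → i = j)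
    (hdisj : ∀ i j, 1 ≤ i → 1 ≤ j → e i ≠ e' j) (m n : ℕ) :
    cov[QB a c₀ s e m, QB a c₀ s e' n; srcMeasure] = σ2 * a ^ (m + n) := by
  induction n with
  | zero =>
      have h0 : QB a c₀ s e' 0 = QB a c₀ s e 0 := by rw [QB_zero, QB_zero]
      rw [h0, covariance_comm, show m = 0 + m by ring, covariance_QB_QB σ2 hc hs he 0 m]
      simp
  | succ n ih =>
      have hfresh : cov[QB a c₀ s e m, X (e' (n + 1)); srcMeasure] = 0 :=
        covariance_QB_X_fresh (he'.1 _ (by omega))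
          fun j hj1 _ heq => hdisj j (n + 1) hj1 (by omega) heq
      rw [covariance_QB_succ_right e' n (memLp_QB e m), ih, hfresh, show m + (n + 1) = (m + n) + 1 by ring,
        pow_succ]
      ring

end Branch

/-! ## the two-sided field -/

section Field

variable (a c₀ s : ℝ)

/-- right innovations [folklore] -/
def eR : ℕ → Idx := fun j => Sum.inl (j : ℤ)
/-- left innovations [folklore] -/
def eL : ℕ → Idx := fun j => Sum.inl (-(j : ℤ))

/-- The right innovations avoid the origin and are injective. [folklore] -/
theorem goodBranch_eR : (∀ j, 1 ≤ j → eR j ≠ Sum.inl 0) ∧ ∀ i j, 1 ≤ i → 1 ≤ j → eR i = eR j → i = j :=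
  ⟨fun j _hj h => by simp [eR] at h; omega, fun i j _ _ h => by simpa [eR] using h⟩

/-- The left innovations avoid the origin and are injective. [folklore] -/
theorem goodBranch_eL : (∀ j, 1 ≤ j → eL j ≠ Sum.inl 0) ∧ ∀ i j, 1 ≤ i → 1 ≤ j → eL i = eL j → i = j :=
  ⟨fun j _hj h => by simp [eL] at h; omega, fun i j _ _ h => by simpa [eL] using h⟩

/-- Right and left innovations are disjoint. [folklore] -/
theorem eR_ne_eL (i j : ℕ) (hi : 1 ≤ i) (_hj : 1 ≤ j) : eR i ≠ eL j := by
  simp [eR, eL]; omega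

/-- the stationary field: `Q (n) = QB eR n`, `Q (-(n+1)) = QB eL (n+1)` [folklore] -/
def Q : ℤ → Src → ℝ
  | (Int.ofNat n) => QB a c₀ s eR n
  | (Int.negSucc n) => QB a c₀ s eL (n + 1)

variable {a c₀ s}

/-- Unfolding `Q` on naturals. [folklore] -/
theorem Q_natCast (n : ℕ) : Q a c₀ s (n : ℤ) = QB a c₀ s eR n := rfl
/-- Unfolding `Q` on negatives. [folklore] -/
theorem Q_negSucc (n : ℕ) : Q a c₀ s (Int.negSucc n) = QB a c₀ s eL (n + 1) := rfl

/-- Unfolding `Q 0`. [folklore] -/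
theorem Q_zero : Q a c₀ s 0 = QB a c₀ s eR 0 := rfl

/-- The field is square integrable. [folklore] -/
theorem memLp_Q (m : ℤ) : MemLp (Q a c₀ s m) 2 srcMeasure := by
  cases m <;> exact memLp_QB _ _

/-- The field is centred. [folklore] -/
theorem integral_Q (m : ℤ) : ∫ ζ, Q a c₀ s m ζ ∂srcMeasure = 0 := by
  cases m <;> exact integral_QB _ _

/-- Branch variables are continuous functions of the source. [folklore] -/
theorem continuous_QB (e : ℕ → Idx) (n : ℕ) : Continuous (QB a c₀ s e n) := continuous_linc _ _ _

/-- The field is a continuous function of the source. [folklore] -/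
theorem continuous_Q (m : ℤ) : Continuous (Q a c₀ s m) := by
  cases m <;> exact continuous_QB _ _

variable (σ2 : ℝ) (hc : c₀ ^ 2 = σ2) (hs : s ^ 2 = σ2 * (1 - a ^ 2))
include hc hs

/-- the covariance of the field: `σ² a^{|m-n|}` [folklore] -/
theorem covariance_Q_Q (m n : ℤ) :
    cov[Q a c₀ s m, Q a c₀ s n; srcMeasure] = σ2 * a ^ (m - n).natAbs := by
  -- reduce to `m ≤ n`-type statements on the branches
  have key : ∀ m n : ℤ, m ≤ n → cov[Q a c₀ s m, Q a c₀ s n; srcMeasure] = σ2 * a ^ (n - m).natAbs := by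
    intro m n hmn
    obtain ⟨i, rfl | rfl⟩ := Int.eq_nat_or_neg m <;> obtain ⟨j, rfl | rfl⟩ := Int.eq_nat_or_neg n
    · -- both ≥ 0
      obtain ⟨d, rfl⟩ : ∃ d, j = i + d := ⟨j - i, by omega⟩
      rw [Q_natCast, Q_natCast, covariance_QB_QB σ2 hc hs goodBranch_eR]
      congr 2
      omega
    · -- i ≥ 0, n = -j with -j ≥ i: then i = j = 0
      have hi : i = 0 := by omega
      have hj : j = 0 := by omega
      subst hi; subst hj
      have h := covariance_QB_QB σ2 hc hs goodBranch_eR 0 0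
      simp only [Nat.cast_zero, neg_zero]
      rw [Q_zero]
      simpa using h
    · -- m = -i ≤ j
      rcases i with _ | i
      · simp only [Nat.cast_zero, neg_zero]
        rw [Q_zero, Q_natCast, show j = 0 + j by ring, covariance_QB_QB σ2 hc hs goodBranch_eR 0 j]
        congr 2
        omega
      · rw [show (-((i + 1 : ℕ) : ℤ)) = Int.negSucc i from rfl, Q_negSucc, Q_natCast,
          covariance_comm,
          covariance_QB_QB' σ2 hc hs goodBranch_eR goodBranch_eL eR_ne_eL j (i + 1)]
        congr 2
    · -- both ≤ 0: m = -i ≤ n = -j, so j ≤ i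
      rcases j with _ | j
      · rcases i with _ | i
        · have h := covariance_QB_QB σ2 hc hs goodBranch_eR 0 0
          simp only [Nat.cast_zero, neg_zero]
          rw [Q_zero]
          simpa using h
        · simp only [Nat.cast_zero, neg_zero]
          rw [show (-((i + 1 : ℕ) : ℤ)) = Int.negSucc i from rfl, Q_negSucc, Q_zero, covariance_comm,
            covariance_QB_QB' σ2 hc hs goodBranch_eR goodBranch_eL eR_ne_eL 0 (i + 1)]
          congr 2
      · obtain ⟨d, rfl⟩ : ∃ d, i = j + 1 + d := ⟨i - (j + 1), by omega⟩
        have e1 : (-((j + 1 + d : ℕ) : ℤ)) = Int.negSucc (j + d) := by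
          rw [Int.negSucc_eq]; push_cast; ring
        rw [e1, show (-((j + 1 : ℕ) : ℤ)) = Int.negSucc j from rfl, Q_negSucc, Q_negSucc,
          covariance_comm, show j + d + 1 = (j + 1) + d by ring,
          covariance_QB_QB σ2 hc hs goodBranch_eL]
        congr 2
        rw [Int.negSucc_eq, Int.negSucc_eq]
        omega
  rcases le_total m n with h | h
  · rw [key m n h]
    congr 2
    omega
  · rw [covariance_comm, key n m h]

omit hc hs in
/-- momenta are uncorrelated with the field [folklore] -/
theorem covariance_Q_Xinr (m n : ℤ) : cov[Q a c₀ s m, X (Sum.inr n); srcMeasure] = 0 := by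
  cases m
  · exact covariance_QB_X_fresh (by simp) fun j _ _ => by simp [eR]
  · exact covariance_QB_X_fresh (by simp) fun j _ _ => by simp [eL]

end Field

/-! ## continuous linear functionals on a product depend on finitely many coordinates -/

/-- A continuous linear functional on a product `ι → F` (product topology) depends on finitely many coordinates: `L x = ∑_{i ∈ S} L (single i (x i))`. [folklore] -/
theorem clm_pi_finite_support {ι : Type*} [DecidableEq ι] {F : Type*} [NormedAddCommGroup F]
    [NormedSpace ℝ F] (L : (ι → F) →L[ℝ] ℝ) :
    ∃ S : Finset ι, ∀ x : ι → F, L x = ∑ i ∈ S, L (Pi.single i (x i)) := by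
  have h0 : (L : (ι → F) → ℝ) ⁻¹' Metric.ball 0 1 ∈ 𝓝 (0 : ι → F) := by
    apply L.continuous.continuousAt.preimage_mem_nhds
    rw [map_zero]; exact Metric.ball_mem_nhds 0 one_pos
  rw [nhds_pi, Filter.mem_pi] at h0
  obtain ⟨I, hI, t, ht, hsub⟩ := h0
  have hvan : ∀ y : ι → F, (∀ i ∈ I, y i = 0) → L y = 0 := by
    intro y hy
    by_contra hne
    have key : ∀ c : ℝ, |c * L y| < 1 := by
      intro c
      have hmem : c • y ∈ I.pi t := fun i hi => by
        simp only [Pi.smul_apply, hy i hi, smul_zero]; exact mem_of_mem_nhds (ht i)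
      have h1 := hsub hmem
      simp only [Set.mem_preimage, Metric.mem_ball, dist_zero_right, Real.norm_eq_abs, map_smul,
        smul_eq_mul] at h1
      exact h1
    have h2 := key (2 / L y)
    rw [div_mul_cancel₀ _ hne] at h2
    norm_num at h2
  refine ⟨hI.toFinset, fun x => ?_⟩
  have hx : L (x - ∑ i ∈ hI.toFinset, Pi.single i (x i)) = 0 := by
    apply hvan
    intro i hi
    rw [Pi.sub_apply, Finset.sum_apply, Finset.sum_pi_single, if_pos (hI.mem_toFinset.2 hi), sub_self]
  rw [map_sub, map_sum, sub_eq_zero] at hx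
  exact hx

/-! ## Gaussianity -/

section Gauss

/-- Each coordinate has Gaussian law. [folklore] -/
theorem hasGaussianLaw_X (i : Idx) : HasGaussianLaw (X i) srcMeasure := by
  refine ⟨?_⟩
  rw [map_X]; infer_instance

/-- The coordinate process is Gaussian (independent Gaussian marginals). [folklore] -/
theorem isGaussianProcess_X : IsGaussianProcess X srcMeasure where
  hasGaussianLaw I :=
    iIndepFun.hasGaussianLaw (fun i : I => hasGaussianLaw_X i.1)
      (iIndepFun.precomp Subtype.val_injective iIndepFun_X)

/-- a `linc` is a finite linear combination of the coordinate process [folklore] -/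
theorem linc_repr {β : Type*} (κ : Finset β) (node : β → Idx) (w : β → ℝ) :
    ∃ I : Finset Idx, ∃ L : (I → ℝ) →L[ℝ] ℝ, ∀ ζ, linc κ node w ζ = L (I.restrict (X · ζ)) := by
  classical
  refine ⟨κ.image node, ∑ b ∈ κ.attach, w b.1 •
    ContinuousLinearMap.proj (R := ℝ) (⟨node b.1, Finset.mem_image_of_mem node b.2⟩ : κ.image node),
    fun ζ => ?_⟩
  simp only [linc, FunLike.coe_sum, FunLike.coe_smul, Finset.sum_apply,
    Pi.smul_apply, ContinuousLinearMap.proj_apply, Finset.restrict_def, smul_eq_mul]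
  exact (Finset.sum_attach κ fun b => w b * X (node b) ζ).symm

variable (a c₀ s : ℝ)

/-- the joint process: field at `inl`, momenta at `inr` [folklore] -/
def Zproc : Idx → Src → ℝ
  | (Sum.inl m) => Q a c₀ s m
  | (Sum.inr m) => X (Sum.inr m)

/-- The joint process is Gaussian. [folklore] -/
theorem isGaussianProcess_Z : IsGaussianProcess (Zproc a c₀ s) srcMeasure := by
  refine isGaussianProcess_X.of_isGaussianProcess fun t => ?_
  rcases t with m | m
  · rcases m with n | n
    · exact linc_repr (Finset.range (n + 1)) (node eR) (coef a c₀ s n)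
    · exact linc_repr (Finset.range (n + 1 + 1)) (node eL) (coef a c₀ s (n + 1))
  · classical
    exact ⟨{Sum.inr m}, ContinuousLinearMap.proj (R := ℝ) (⟨Sum.inr m, by simp⟩ : ({Sum.inr m} : Finset Idx)),
      fun ζ => rfl⟩

/-- the configuration-valued map [folklore] -/
def Φ : Src → (ℤ → ℝ × ℝ) := fun ζ m => (Q a c₀ s m ζ, X (Sum.inr m) ζ)

/-- `Φ` is continuous. [folklore] -/
theorem continuous_Φ : Continuous (Φ a c₀ s) :=
  continuous_pi fun m => (continuous_Q m).prodMk (continuous_apply _)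

/-- `Φ` is measurable. [folklore] -/
theorem measurable_Φ : Measurable (Φ a c₀ s) := (continuous_Φ a c₀ s).measurable

/-- the law of the field is a Gaussian measure on `ℤ → ℝ × ℝ` [folklore] -/
theorem isGaussian_map_Φ : IsGaussian (srcMeasure.map (Φ a c₀ s)) := by
  classical
  refine isGaussian_of_isGaussian_map fun L => ?_
  obtain ⟨S, hS⟩ := clm_pi_finite_support L
  set W : ℤ → Src → ℝ := fun i ζ => L (Pi.single i ((1 : ℝ), (0 : ℝ))) * Zproc a c₀ s (Sum.inl i) ζ +
    L (Pi.single i ((0 : ℝ), (1 : ℝ))) * Zproc a c₀ s (Sum.inr i) ζ with hW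
  have hWg : IsGaussianProcess W srcMeasure := by
    refine (isGaussianProcess_Z a c₀ s).of_isGaussianProcess fun i => ?_
    refine ⟨{Sum.inl i, Sum.inr i},
      L (Pi.single i ((1 : ℝ), (0 : ℝ))) • ContinuousLinearMap.proj (R := ℝ)
          (⟨Sum.inl i, by simp⟩ : ({Sum.inl i, Sum.inr i} : Finset Idx)) +
        L (Pi.single i ((0 : ℝ), (1 : ℝ))) • ContinuousLinearMap.proj (R := ℝ)
          (⟨Sum.inr i, by simp⟩ : ({Sum.inl i, Sum.inr i} : Finset Idx)),
      fun ζ => ?_⟩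
    simp [hW, Finset.restrict_def]
  have hsum := hWg.hasGaussianLaw_fun_sum (I := S)
  have heq : (fun ζ => ∑ i ∈ S, W i ζ) = L ∘ Φ a c₀ s := by
    funext ζ
    rw [Function.comp_apply, hS]
    refine Finset.sum_congr rfl fun i _ => ?_
    have hsplit : Pi.single i (Φ a c₀ s ζ i) =
        (Φ a c₀ s ζ i).1 • Pi.single (M := fun _ : ℤ => ℝ × ℝ) i ((1 : ℝ), (0 : ℝ)) +
          (Φ a c₀ s ζ i).2 • Pi.single (M := fun _ : ℤ => ℝ × ℝ) i ((0 : ℝ), (1 : ℝ)) := by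
      rw [← Pi.single_smul, ← Pi.single_smul, ← Pi.single_add]
      congr 1
      ext <;> simp
    rw [hsplit, map_add, map_smul, map_smul, smul_eq_mul, smul_eq_mul]
    simp only [hW, Zproc, Φ]
    ring
  rw [heq] at hsum
  rw [Measure.map_map L.continuous.measurable (measurable_Φ a c₀ s)]
  exact hsum.isGaussian_map

end Gauss

/-! ## The flat-profile Gaussian state at `ω₂ = 1/2`, `T = 1`, and the refutation -/

section Final

/-- `c₀ = σ` [folklore] -/
def c0P : ℝ := Real.sqrt sigmaSq
/-- `s = σ √(1 - a²)`, `a = 1/2` [folklore] -/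
def sP : ℝ := Real.sqrt (sigmaSq * (1 - (1 / 2 : ℝ) ^ 2))

/-- `c₀² = σ²`. [folklore] -/
theorem c0P_sq : c0P ^ 2 = sigmaSq := Real.sq_sqrt sigmaSq_nonneg
/-- `s² = σ² (1 - 1/4)`. [folklore] -/
theorem sP_sq : sP ^ 2 = sigmaSq * (1 - (1 / 2 : ℝ) ^ 2) :=
  Real.sq_sqrt (mul_nonneg sigmaSq_nonneg (by norm_num))

/-- the law of the field has exactly the flat-profile spectral covariances [folklore] -/
theorem isProfileState_map_Φ :
    IsProfileState (1 / 2) (srcMeasure.map (Φ (1 / 2) c0P sP)) fun _ => (1 : ℝ) := by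
  have hΦ : AEMeasurable (Φ (1 / 2) c0P sP) srcMeasure := (measurable_Φ (1 / 2) c0P sP).aemeasurable
  have h1 : ∀ m : ℤ, Continuous fun σ : ChainConfig => (σ m).1 := fun m => by fun_prop
  have h2 : ∀ m : ℤ, Continuous fun σ : ChainConfig => (σ m).2 := fun m => by fun_prop
  refine ⟨fun m => ⟨?_, ?_⟩, fun m n => ⟨?_, ?_, ?_⟩⟩
  · rw [integral_map hΦ (h1 m).aestronglyMeasurable]
    exact integral_Q m
  · rw [integral_map hΦ (h2 m).aestronglyMeasurable]
    exact integral_X (Sum.inr m)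
  · rw [covariance_map_fun (h1 m).aestronglyMeasurable (h1 n).aestronglyMeasurable hΦ]
    show cov[Q (1 / 2) c0P sP m, Q (1 / 2) c0P sP n; srcMeasure] = _
    rw [covariance_Q_Q sigmaSq c0P_sq sP_sq, profileCovQQ_flat]
  · rw [covariance_map_fun (h2 m).aestronglyMeasurable (h2 n).aestronglyMeasurable hΦ]
    show cov[X (Sum.inr m), X (Sum.inr n); srcMeasure] = _
    rw [covariance_X_X, profileCovPP_flat]
    by_cases h : m = n
    · subst h; simp
    · rw [if_neg (by simpa using h), if_neg h]
  · rw [covariance_map_fun (h1 m).aestronglyMeasurable (h2 n).aestronglyMeasurable hΦ]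
    show cov[Q (1 / 2) c0P sP m, X (Sum.inr n); srcMeasure] = _
    rw [covariance_Q_Xinr, profileCovQP_const]

end Final

/-- **Non-vacuity of `IsProfileState`**: the thermal (flat-profile, `T = 1`) Gaussian state of the
pinned harmonic host with `ω₂ = 1/2` exists as a Gaussian measure on `ChainConfig` — an outward
two-sided AR(1) position field with white momenta over the infinite product of standard Gaussians.
[folklore] -/
theorem exists_isGaussian_isProfileState :
    ∃ ν : Measure ChainConfig, IsGaussian ν ∧ IsProfileState (1 / 2) ν fun _ => (1 : ℝ) :=
  ⟨srcMeasure.map (Φ (1 / 2) c0P sP), isGaussian_map_Φ _ _ _, isProfileState_map_Φ⟩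

end

end FlatProfileState

end Literature.MathematicalPhysics.KineticTheory.HeatConduction
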